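import Literature.AnabelianGeometry.EtaleTheta.EtaleThetaClass
import Literature.AnabelianGeometry.EtaleTheta.SettingCompletion
import HarnessLib

/-!
# [EtTh] §2 at the §1 MODEL, phase 1a: the subgroups `Ker(Δ_X ↠ Δ̄_X) ⊆ Δ̄_Θ-preimage ⊆ Δ_X` of the
# PROFINITE `Π_X` (model definitions for `ThetaCovers.CoverData` over a `ThetaSetting`)

Mochizuki, *The étale theta function and its Frobenioid-theoretic manifestations*, Publ. RIMS **45**
(2009) [EtTh], §2, PRIMS PDF p. 35 (printed p. 261): "we shall denote the (profinite) étale fundamental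
group of `X^log` by `Π_X` … `1 → Δ_X → Π_X → G_K → 1` … Since `Δ_X` is a profinite free group on 2
generators, the quotient `Δ^Θ_X := Δ_X/[Δ_X, [Δ_X, Δ_X]]` fits into a natural exact sequence
`1 → Δ_Θ → Δ^Θ_X → Δ^ell_X → 1` … Now let `l ≥ 1` be an integer. One verifies easily by considering the
well-known structure of `Δ^Θ_X` that the subgroup of `Δ^Θ_X` generated by `l`-th powers of elements of
`Δ^Θ_X` is normal. We shall write `Δ^Θ_X ↠ Δ̄_X` for the quotient of `Δ^Θ_X` by this normal subgroup.
Thus, the above exact sequence for `Δ^Θ_X` determines a quotient exact sequence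
`1 → Δ̄_Θ → Δ̄_X → Δ̄^ell_X → 1` — where `Δ̄_Θ ≅ (ℤ/lℤ)(1)`; `Δ̄^ell_X` is a free `(ℤ/lℤ)`-module of rank
`2`" [cite: MochizukiEtTh2009, Def 2.1 p.35]. ERRATUM E1 ([IUTchI] Rmk. 3.1.6): `l` must be ODD for
`Δ̄_X` to behave as printed (relevant to the numerology file only).

Layer L2 of the abc-iut cell, merge row W3-L2-02 / P2-a (seat abc-iut-L2-t10, gen 4; L2-lead RULING
2026-08-26T02:06:46Z + GO 02:37:36Z; census memo of abc-iut-L2-d3 `W3-L2-02-CENSUS.md` §3). Purpose: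
abc-iut-L2-t2's interface `ThetaCovers.CoverData` (ThetaCovers.lean) carries `Ker(Δ_X ↠ Δ̄_X)` and the
`Δ̄_Θ`-preimage as subgroups `barKer ≤ barTheta ≤ Δ_X` of the PROFINITE `Π_C ⊇ Π_X` with the printed
properties; no instance of it exists in the tree. This file DEFINES the two subgroups at the §1 model —
inside `Π_X := D.PiHat`, the profinite completion of `Π^tp_X` carried by abc-iut-L2-t1's `ThetaSetting`
(`TemperedCurve.PiHat`; `Δ_X := D.DeltaHat`, free profinite on two generators under `IsEtThOrigin`,
p. 12) — and proves their hypothesis-free properties: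

* `ThetaSetting.deltaHatPow D l` — the normal subgroup of `Π_X` generated by the `l`-th powers of
  elements of `Δ_X` ("the subgroup … generated by `l`-th powers", p. 35; its image in `Δ^Θ_X` is the
  printed one);
* `ThetaSetting.barKerHat D l := ([[Δ_X,Δ_X],Δ_X] · deltaHatPow)⁻` — the closed normal subgroup
  `Ker(Δ_X ↠ Δ̄_X)` ("subgroups of quotients are carried as their inverse images", ThetaCovers.lean);
* `ThetaSetting.barThetaHat D l := ([Δ_X,Δ_X] · deltaHatPow)⁻` — the inverse image of
  `Δ̄_Θ = Im(Δ_Θ) = Im(∧² Δ^ell_X)` in `Δ_X`;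
* closedness, normality IN `Π_X`, `barKerHat ≤ barThetaHat ≤ Δ_X`, `d ^ l ∈ barKerHat` for `d ∈ Δ_X`
  (`CoverDataAx.pow_mem_barKer` shape), `[Δ_X,Δ_X] ≤ barThetaHat`, and the CENTRALITY
  `barThetaHat_central : ∀ t ∈ barThetaHat, ∀ d ∈ Δ_X, t d t⁻¹ d⁻¹ ∈ barKerHat` ("`Δ̄_Θ` is central in
  `Δ̄_X`", the `CoverData.barTheta_central` shape — via the class-two identity `[y^n, d] ≡ [y, d]^n`
  modulo `[[Δ_X,Δ_X],Δ_X]`);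
* the tempered shadows `Ker(Π^tp_X ↠ (Π^tp_X)^Θ) ≤ toHat⁻¹(barKerHat)` and
  `Ker(Π^tp_X ↠ (Π^tp_X)^ell) ≤ toHat⁻¹(barThetaHat)` (root axioms `ker_toTheta`, `ker_toEll`).

The NUMEROLOGY under `IsEtThOrigin` (`[barThetaHat : barKerHat] = l`, `Δ_X/barThetaHat ≅ (ℤ/lℤ)²`) is
the proof-only companion `ThetaCoversModelHeisenberg.lean`; the `Π_C`-side assembly of `CoverDataAx`
is `ThetaCoversAxOfSetting.lean`. DEFINITIONS + kernel-checked lemmas only; no instance, no new named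
fact; [EtTh] is refereed; nothing here takes a side on [IUTchIII] Cor. 3.12.
-/

noncomputable section

namespace Literature.AnabelianGeometry.EtaleTheta

namespace ThetaSetting

open scoped commutatorElement

variable {p : ℕ} [Fact p.Prime] (D : ThetaSetting p) (l : ℕ)

/-! ### The three subgroups -/

/-- **The normal subgroup of `Π_X` generated by the `l`-th powers of elements of `Δ_X`** ("the subgroup
of `Δ^Θ_X` generated by `l`-th powers of elements of `Δ^Θ_X` is normal", p. 35 — carried as a subgroup
of `Π_X`; its image in `Δ^Θ_X = Δ_X/[Δ_X,[Δ_X,Δ_X]]` is the printed subgroup). The generating set is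
invariant under conjugation by `Π_X` (`Δ_X ⊴ Π_X`), so this is the subgroup it generates, written as a
`normalClosure` for the normality bookkeeping. [cite: MochizukiEtTh2009, Def 2.1 p.35] -/
def deltaHatPow : Subgroup D.PiHat :=
  Subgroup.normalClosure {x : D.PiHat | ∃ y ∈ D.DeltaHat, x = y ^ l}

/-- **`Ker(Δ_X ↠ Δ̄_X)` at the model**, as a closed subgroup of the profinite `Π_X`: the closure of
`[[Δ_X,Δ_X],Δ_X] · ⟨l-th powers of Δ_X⟩` (`Δ̄_X :=` the quotient of `Δ^Θ_X = Δ_X/[Δ_X,[Δ_X,Δ_X]]` by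
the normal subgroup generated by `l`-th powers, p. 35) — the field `ThetaCovers.CoverData.barKer` at
the model. [cite: MochizukiEtTh2009, Def 2.1 p.35] -/
def barKerHat : Subgroup D.PiHat :=
  (⁅⁅D.DeltaHat, D.DeltaHat⁆, D.DeltaHat⁆ ⊔ D.deltaHatPow l).topologicalClosure

/-- **The inverse image in `Δ_X` of `Δ̄_Θ ⊆ Δ̄_X`** at the model (`Δ̄_Θ` = the image of
`Δ_Θ = Im(∧² Δ^ell_X) ⊆ Δ^Θ_X`, i.e. of `[Δ_X,Δ_X]`, p. 35), as a closed subgroup of `Π_X`: the closure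
of `[Δ_X,Δ_X] · ⟨l-th powers of Δ_X⟩` — the field `ThetaCovers.CoverData.barTheta` at the model.
[cite: MochizukiEtTh2009, Def 2.1 p.35] -/
def barThetaHat : Subgroup D.PiHat :=
  (⁅D.DeltaHat, D.DeltaHat⁆ ⊔ D.deltaHatPow l).topologicalClosure

/-! ### Normality and closedness -/

/-- `Δ_X ⊴ Π_X` (abc-iut-L2-t7's `SettingCompletion.deltaHat_normal`, re-exported in dot notation).
[cite: MochizukiEtTh2009, §1 p.12] -/
theorem deltaHat_normal' : D.DeltaHat.Normal :=
  SettingCompletion.deltaHat_normal D.toTemperedCurve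

/-- The `l`-th powers of `Δ_X` form a conjugation-invariant subset of `Π_X` (`Δ_X ⊴ Π_X`).
[cite: MochizukiEtTh2009, Def 2.1 p.35] -/
theorem conj_mem_powSet {x : D.PiHat} (hx : x ∈ {x : D.PiHat | ∃ y ∈ D.DeltaHat, x = y ^ l})
    (g : D.PiHat) : g * x * g⁻¹ ∈ {x : D.PiHat | ∃ y ∈ D.DeltaHat, x = y ^ l} := by
  obtain ⟨y, hy, rfl⟩ := hx
  exact ⟨g * y * g⁻¹, (D.deltaHat_normal').conj_mem y hy g, by rw [conj_pow]⟩

/-- `deltaHatPow` is normal in `Π_X`. [cite: MochizukiEtTh2009, Def 2.1 p.35] -/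
theorem deltaHatPow_normal : (D.deltaHatPow l).Normal :=
  Subgroup.normalClosure_normal

/-- `deltaHatPow` is the subgroup GENERATED by the `l`-th powers (no further conjugates needed).
[cite: MochizukiEtTh2009, Def 2.1 p.35] -/
theorem deltaHatPow_eq_closure :
    D.deltaHatPow l = Subgroup.closure {x : D.PiHat | ∃ y ∈ D.DeltaHat, x = y ^ l} := by
  refine le_antisymm ?_ Subgroup.closure_le_normalClosure
  change Subgroup.closure (Group.conjugatesOfSet _) ≤ _
  refine Subgroup.closure_mono fun x hx => ?_
  obtain ⟨a, ha, hax⟩ := Group.mem_conjugatesOfSet_iff.1 hx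
  obtain ⟨c, rfl⟩ := isConj_iff.1 hax
  exact D.conj_mem_powSet l ha c

/-- Every `l`-th power of an element of `Δ_X` lies in `deltaHatPow`. [cite: MochizukiEtTh2009, Def 2.1 p.35] -/
theorem pow_mem_deltaHatPow {y : D.PiHat} (hy : y ∈ D.DeltaHat) : y ^ l ∈ D.deltaHatPow l :=
  Subgroup.subset_normalClosure ⟨y, hy, rfl⟩

/-- `deltaHatPow ≤ Δ_X` (`Δ_X` is normal and contains the generators). [cite: MochizukiEtTh2009, Def 2.1 p.35] -/
theorem deltaHatPow_le_deltaHat : D.deltaHatPow l ≤ D.DeltaHat := by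
  haveI := D.deltaHat_normal'
  refine Subgroup.normalClosure_le_normal ?_
  rintro _ ⟨y, hy, rfl⟩
  exact D.DeltaHat.pow_mem hy l

/-- `Ker(Δ_X ↠ Δ̄_X)` is normal in `Π_X` ("it is normal in `Π_C` (characteristic in `Δ_X`)",
`CoverData.barKer_normal`; here at the `Π_X`-level). [cite: MochizukiEtTh2009, Def 2.1 p.35] -/
theorem barKerHat_normal : (D.barKerHat l).Normal := by
  haveI := D.deltaHat_normal'
  haveI := D.deltaHatPow_normal l
  haveI : (⁅⁅D.DeltaHat, D.DeltaHat⁆, D.DeltaHat⁆ ⊔ D.deltaHatPow l).Normal := Subgroup.sup_normal _ _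
  exact Subgroup.is_normal_topologicalClosure _

/-- The `Δ̄_Θ`-preimage is normal in `Π_X` (`CoverData.barTheta_normal` shape, `Π_X`-level).
[cite: MochizukiEtTh2009, Def 2.1 p.35] -/
theorem barThetaHat_normal : (D.barThetaHat l).Normal := by
  haveI := D.deltaHat_normal'
  haveI := D.deltaHatPow_normal l
  haveI : (⁅D.DeltaHat, D.DeltaHat⁆ ⊔ D.deltaHatPow l).Normal := Subgroup.sup_normal _ _
  exact Subgroup.is_normal_topologicalClosure _

/-- `Ker(Δ_X ↠ Δ̄_X)` is closed in `Π_X` (the REPAIRED field `CoverData.isClosed_barKer` of the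
interface, GAP-LEDGER G-L2d3-5 R1). [cite: MochizukiEtTh2009, Def 2.1 p.35] -/
theorem isClosed_barKerHat : IsClosed (D.barKerHat l : Set D.PiHat) :=
  Subgroup.isClosed_topologicalClosure _

/-- The `Δ̄_Θ`-preimage is closed in `Π_X`. [cite: MochizukiEtTh2009, Def 2.1 p.35] -/
theorem isClosed_barThetaHat : IsClosed (D.barThetaHat l : Set D.PiHat) :=
  Subgroup.isClosed_topologicalClosure _

/-! ### Inclusions -/

/-- `[[Δ_X,Δ_X],Δ_X] ≤ Ker(Δ_X ↠ Δ̄_X)` (`Δ̄_X` is a quotient of `Δ^Θ_X = Δ_X/[Δ_X,[Δ_X,Δ_X]]`).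
[cite: MochizukiEtTh2009, Def 2.1 p.35] -/
theorem tripleCommutator_le_barKerHat : ⁅⁅D.DeltaHat, D.DeltaHat⁆, D.DeltaHat⁆ ≤ D.barKerHat l :=
  le_sup_left.trans (Subgroup.le_topologicalClosure _)

/-- `[[Δ_X,Δ_X],Δ_X]⁻ ≤ Ker(Δ_X ↠ Δ̄_X)`. [cite: MochizukiEtTh2009, Def 2.1 p.35] -/
theorem tripleCommutatorClosure_le_barKerHat :
    (⁅⁅D.DeltaHat, D.DeltaHat⁆, D.DeltaHat⁆).topologicalClosure ≤ D.barKerHat l :=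
  Subgroup.topologicalClosure_minimal _ (D.tripleCommutator_le_barKerHat l) (D.isClosed_barKerHat l)

/-- `deltaHatPow ≤ Ker(Δ_X ↠ Δ̄_X)`. [cite: MochizukiEtTh2009, Def 2.1 p.35] -/
theorem deltaHatPow_le_barKerHat : D.deltaHatPow l ≤ D.barKerHat l :=
  le_sup_right.trans (Subgroup.le_topologicalClosure _)

/-- **`d ^ l ∈ Ker(Δ_X ↠ Δ̄_X)` for `d ∈ Δ_X`** (`Δ̄_X` has exponent `l`; the field
`CoverDataAx.pow_mem_barKer` at the model). [cite: MochizukiEtTh2009, Def 2.1 p.35] -/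
theorem pow_mem_barKerHat {d : D.PiHat} (hd : d ∈ D.DeltaHat) : d ^ l ∈ D.barKerHat l :=
  D.deltaHatPow_le_barKerHat l (D.pow_mem_deltaHatPow l hd)

/-- `[Δ_X,Δ_X] ≤ Δ̄_Θ`-preimage (`Δ̄_Θ` is the image of `Δ_Θ`, itself the image of `[Δ_X,Δ_X]`).
[cite: MochizukiEtTh2009, Def 2.1 p.35] -/
theorem commutator_le_barThetaHat : ⁅D.DeltaHat, D.DeltaHat⁆ ≤ D.barThetaHat l :=
  le_sup_left.trans (Subgroup.le_topologicalClosure _)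

/-- `[Δ_X,Δ_X]⁻ ≤ Δ̄_Θ`-preimage. [cite: MochizukiEtTh2009, Def 2.1 p.35] -/
theorem commutatorClosure_le_barThetaHat :
    (⁅D.DeltaHat, D.DeltaHat⁆).topologicalClosure ≤ D.barThetaHat l :=
  Subgroup.topologicalClosure_minimal _ (D.commutator_le_barThetaHat l) (D.isClosed_barThetaHat l)

/-- A single commutator of elements of `Δ_X` lies in the `Δ̄_Θ`-preimage. [cite: MochizukiEtTh2009, Def 2.1 p.35] -/
theorem commutator_mem_barThetaHat {u v : D.PiHat} (hu : u ∈ D.DeltaHat) (hv : v ∈ D.DeltaHat) :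
    u * v * u⁻¹ * v⁻¹ ∈ D.barThetaHat l := by
  have h := D.commutator_le_barThetaHat l (Subgroup.commutator_mem_commutator hu hv)
  rwa [commutatorElement_def] at h

/-- `deltaHatPow ≤ Δ̄_Θ`-preimage. [cite: MochizukiEtTh2009, Def 2.1 p.35] -/
theorem deltaHatPow_le_barThetaHat : D.deltaHatPow l ≤ D.barThetaHat l :=
  le_sup_right.trans (Subgroup.le_topologicalClosure _)

/-- **`Ker(Δ_X ↠ Δ̄_X) ≤ Δ̄_Θ`-preimage** (the field `CoverData.barKer_le_barTheta` at the model).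
[cite: MochizukiEtTh2009, Def 2.1 p.35] -/
theorem barKerHat_le_barThetaHat : D.barKerHat l ≤ D.barThetaHat l := by
  haveI := D.deltaHat_normal'
  exact Subgroup.topologicalClosure_minimal _
    (sup_le ((Subgroup.commutator_le_left _ _).trans (D.commutator_le_barThetaHat l))
      (D.deltaHatPow_le_barThetaHat l))
    (D.isClosed_barThetaHat l)

/-- **`Δ̄_Θ`-preimage `≤ Δ_X`** (the field `CoverData.barTheta_le` at the model, `Π_X`-level).
[cite: MochizukiEtTh2009, Def 2.1 p.35] -/
theorem barThetaHat_le_deltaHat : D.barThetaHat l ≤ D.DeltaHat :=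
  Subgroup.topologicalClosure_minimal _
    (sup_le ((Subgroup.le_topologicalClosure _).trans D.commutatorClosure_le_deltaHat)
      (D.deltaHatPow_le_deltaHat l))
    (Subgroup.isClosed_topologicalClosure _)

/-- `Ker(Δ_X ↠ Δ̄_X) ≤ Δ_X`. [cite: MochizukiEtTh2009, Def 2.1 p.35] -/
theorem barKerHat_le_deltaHat : D.barKerHat l ≤ D.DeltaHat :=
  (D.barKerHat_le_barThetaHat l).trans (D.barThetaHat_le_deltaHat l)

/-! ### Centrality of `Δ̄_Θ` in `Δ̄_X` -/

/-- Commutators with `Δ_X` of elements of `[Δ_X,Δ_X]` die in `Ker(Δ_X ↠ Δ̄_X)` (they lie in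
`[[Δ_X,Δ_X],Δ_X]`). [cite: MochizukiEtTh2009, Def 2.1 p.35] -/
theorem commutator_mem_barKerHat_of_mem_commutator {t d : D.PiHat} (ht : t ∈ ⁅D.DeltaHat, D.DeltaHat⁆)
    (hd : d ∈ D.DeltaHat) : t * d * t⁻¹ * d⁻¹ ∈ D.barKerHat l := by
  have h := D.tripleCommutator_le_barKerHat l (Subgroup.commutator_mem_commutator ht hd)
  rwa [commutatorElement_def] at h

/-- The elements of `Π_X` whose commutators with all of `Δ_X` lie in `Ker(Δ_X ↠ Δ̄_X)` form a
subgroup (`Ker(Δ_X ↠ Δ̄_X) ⊴ Π_X`). [cite: MochizukiEtTh2009, Def 2.1 p.35] -/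
def centralizerModBarKer : Subgroup D.PiHat where
  carrier := {t | ∀ d ∈ D.DeltaHat, t * d * t⁻¹ * d⁻¹ ∈ D.barKerHat l}
  one_mem' := by
    intro d _
    simp
  mul_mem' {s t} hs ht := by
    intro d hd
    have h1 : s * (t * d * t⁻¹ * d⁻¹) * s⁻¹ ∈ D.barKerHat l := (D.barKerHat_normal l).conj_mem _ (ht d hd) s
    have h2 := (D.barKerHat l).mul_mem h1 (hs d hd)
    convert h2 using 1
    group
  inv_mem' {t} ht := by
    intro d hd
    have h1 : t⁻¹ * (t * d * t⁻¹ * d⁻¹)⁻¹ * t⁻¹⁻¹ ∈ D.barKerHat l :=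
      (D.barKerHat_normal l).conj_mem _ ((D.barKerHat l).inv_mem (ht d hd)) t⁻¹
    convert h1 using 1
    group

/-- Membership in `centralizerModBarKer` (bookkeeping). [cite: MochizukiEtTh2009, Def 2.1 p.35] -/
theorem mem_centralizerModBarKer {t : D.PiHat} :
    t ∈ D.centralizerModBarKer l ↔ ∀ d ∈ D.DeltaHat, t * d * t⁻¹ * d⁻¹ ∈ D.barKerHat l := Iff.rfl

/-- `centralizerModBarKer` is closed (`Ker(Δ_X ↠ Δ̄_X)` is closed and commutators are continuous).
[cite: MochizukiEtTh2009, Def 2.1 p.35] -/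
theorem isClosed_centralizerModBarKer : IsClosed (D.centralizerModBarKer l : Set D.PiHat) := by
  have : (D.centralizerModBarKer l : Set D.PiHat) =
      ⋂ d ∈ (D.DeltaHat : Set D.PiHat), {t : D.PiHat | t * d * t⁻¹ * d⁻¹ ∈ (D.barKerHat l : Set D.PiHat)} := by
    ext t
    simp only [SetLike.mem_coe, mem_centralizerModBarKer, Set.mem_iInter, Set.mem_setOf_eq]
  rw [this]
  exact isClosed_biInter fun d _ => (D.isClosed_barKerHat l).preimage (by fun_prop)

/-- **The class-two power identity**: for `y, d ∈ Δ_X` and every `n`, `[y ^ n, d] = [y, d]^n · k` with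
`k ∈ Ker(Δ_X ↠ Δ̄_X)` (indeed `k ∈ [[Δ_X,Δ_X],Δ_X]⁻`; "the well-known structure of `Δ^Θ_X`", p. 35).
[cite: MochizukiEtTh2009, Def 2.1 p.35] -/
theorem commutator_pow_mem_mul {y d : D.PiHat} (hy : y ∈ D.DeltaHat) (hd : d ∈ D.DeltaHat) (n : ℕ) :
    ∃ k ∈ D.barKerHat l, y ^ n * d * (y ^ n)⁻¹ * d⁻¹ = (y * d * y⁻¹ * d⁻¹) ^ n * k := by
  haveI := D.barKerHat_normal l
  -- in the quotient `Π_X / Ker(Δ_X ↠ Δ̄_X)` the classes of `[y^n, d]` and `[y, d]^n` agree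
  have key : ∀ n : ℕ, (QuotientGroup.mk (y ^ n * d * (y ^ n)⁻¹ * d⁻¹) : D.PiHat ⧸ D.barKerHat l) =
      (QuotientGroup.mk (y * d * y⁻¹ * d⁻¹) : D.PiHat ⧸ D.barKerHat l) ^ n := by
    intro n
    induction n with
    | zero => simp
    | succ n ih =>
      -- `cₙ := [y^n, d] ∈ [Δ_X,Δ_X]`, so `[cₙ, y] ∈ [[Δ_X,Δ_X],Δ_X] ≤ barKer`: their classes commute
      have hcnΔ : y ^ n * d * (y ^ n)⁻¹ * d⁻¹ ∈ ⁅D.DeltaHat, D.DeltaHat⁆ := by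
        rw [← commutatorElement_def]
        exact Subgroup.commutator_mem_commutator (D.DeltaHat.pow_mem hy n) hd
      have hcomm : (QuotientGroup.mk y : D.PiHat ⧸ D.barKerHat l) *
            QuotientGroup.mk (y ^ n * d * (y ^ n)⁻¹ * d⁻¹) =
          QuotientGroup.mk (y ^ n * d * (y ^ n)⁻¹ * d⁻¹) * QuotientGroup.mk y := by
        rw [← QuotientGroup.mk_mul, ← QuotientGroup.mk_mul, QuotientGroup.eq]
        have h := D.commutator_mem_barKerHat_of_mem_commutator l hcnΔ hy
        have h' := (D.barKerHat_normal l).conj_mem _ h (y * (y ^ n * d * (y ^ n)⁻¹ * d⁻¹))⁻¹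
        convert h' using 1
        group
      have hid : y ^ (n + 1) * d * (y ^ (n + 1))⁻¹ * d⁻¹ =
          y * (y ^ n * d * (y ^ n)⁻¹ * d⁻¹) * y⁻¹ * (y * d * y⁻¹ * d⁻¹) := by
        rw [pow_succ]
        group
      rw [hid, pow_succ, ← ih, QuotientGroup.mk_mul, QuotientGroup.mk_mul, QuotientGroup.mk_mul,
        hcomm, QuotientGroup.mk_inv]
      group
  have hmem := (QuotientGroup.eq (s := D.barKerHat l)).1 ((key n).trans (QuotientGroup.mk_pow _ _ _).symm).symm
  refine ⟨((y * d * y⁻¹ * d⁻¹) ^ n)⁻¹ * (y ^ n * d * (y ^ n)⁻¹ * d⁻¹), hmem, ?_⟩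
  group

/-- **`Δ̄_Θ` is central in `Δ̄_X`** at the model: every element of the `Δ̄_Θ`-preimage commutes with
`Δ_X` modulo `Ker(Δ_X ↠ Δ̄_X)` ("`Δ̄_Θ ≅ (ℤ/lℤ)(1)` … `Δ_Θ ⊆` centre of `Δ^Θ_X`", p. 35; the field
`CoverData.barTheta_central` at the model). [cite: MochizukiEtTh2009, Def 2.1 p.35] -/
theorem barThetaHat_central :
    ∀ t ∈ D.barThetaHat l, ∀ d ∈ D.DeltaHat, t * d * t⁻¹ * d⁻¹ ∈ D.barKerHat l := by
  -- `barThetaHat ≤ centralizerModBarKer`: the latter is a closed subgroup containing the generators.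
  suffices h : D.barThetaHat l ≤ D.centralizerModBarKer l from fun t ht => h ht
  refine Subgroup.topologicalClosure_minimal _ (sup_le ?_ ?_) (D.isClosed_centralizerModBarKer l)
  · -- `[Δ_X,Δ_X]`: commutators with `Δ_X` lie in `[[Δ_X,Δ_X],Δ_X] ≤ barKer`
    intro t ht d hd
    exact D.commutator_mem_barKerHat_of_mem_commutator l ht hd
  · -- the `l`-th powers: `[y^l, d] = [y, d]^l · k`, and `[y, d]^l` is an `l`-th power of an element of `Δ_X`
    rw [D.deltaHatPow_eq_closure l, Subgroup.closure_le]
    rintro _ ⟨y, hy, rfl⟩ d hd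
    obtain ⟨k, hk, hkeq⟩ := D.commutator_pow_mem_mul l hy hd l
    rw [hkeq]
    refine (D.barKerHat l).mul_mem (D.pow_mem_barKerHat l ?_) hk
    exact D.DeltaHat.mul_mem (D.DeltaHat.mul_mem (D.DeltaHat.mul_mem hy hd) (D.DeltaHat.inv_mem hy))
      (D.DeltaHat.inv_mem hd)

/-! ### Tempered shadows -/

/-- `Ker(Π^tp_X ↠ (Π^tp_X)^Θ) ≤ toHat⁻¹(Ker(Δ_X ↠ Δ̄_X))` (root axiom `ker_toTheta`: the theta-quotient
kernel is the pull-back of `[[Δ_X,Δ_X],Δ_X]⁻`). [cite: MochizukiEtTh2009, §1 p.12] -/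
theorem ker_toTheta_le_comap_barKerHat :
    D.toTheta.ker ≤ (D.barKerHat l).comap D.toHat.toMonoidHom := by
  rw [D.ker_toTheta]
  exact Subgroup.comap_mono (D.tripleCommutatorClosure_le_barKerHat l)

/-- `Ker(Π^tp_X ↠ (Π^tp_X)^ell) ≤ toHat⁻¹(Δ̄_Θ-preimage)` (root axiom `ker_toEll`: the pull-back of
`[Δ_X,Δ_X]⁻`). [cite: MochizukiEtTh2009, §1 p.12] -/
theorem ker_toEll_le_comap_barThetaHat :
    (D.thetaToEll.comp D.toTheta).ker ≤ (D.barThetaHat l).comap D.toHat.toMonoidHom := by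
  rw [D.ker_toEll]
  exact Subgroup.comap_mono (D.commutatorClosure_le_barThetaHat l)

end ThetaSetting

end Literature.AnabelianGeometry.EtaleTheta

end
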